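import Mathlib
import HarnessLib

/-!
# Route EternalPapapetrou · SchwarzschildExteriorModeRigidity — convolution in the time variable

Helper file for item stmt-FinalStateConjecture-10039 (`SchwarzschildExteriorModeRigidity`).

For a kernel `k : ℝ → ℝ` and a function `U : ℝ × ℝ → E` of `(t, r)` we set
`timeConv k U (t, r) = ∫ k(s) U(t − s, r) ds`, i.e. Mathlib's convolution `k ⋆ U(·, r)` in the
first variable at fixed `r`. This file collects the elementary facts used by the temporal
band-limitation step of the mode-rigidity argument: the `L¹–L^∞` bound, differentiation under
the integral sign in both variables (dominated version, with the bound only required on the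
support of the kernel), commutation with `r`-dependent coefficients and with continuous linear
maps, the integration-by-parts identity `timeConv K' V = timeConv K (∂ₜ V)`, and associativity
`timeConv a (timeConv b V) = timeConv (a ⋆ b) V`. [folklore]
-/

set_option linter.dupNamespace false

noncomputable section

namespace Summit.FinalStateConjecture.FinalStateConjecture.Theorems

open MeasureTheory Set Filter Topology Metric
open scoped Convolution

namespace EternalPapapetrou.ModeRigidity

variable {E : Type*} [NormedAddCommGroup E] [NormedSpace ℝ E]

/-- Convolution in the time variable: `timeConv k U (t, r) = ∫ k(s) • U(t − s, r) ds`
(Mathlib's `k ⋆[lsmul ℝ ℝ] U(·, r)` evaluated at `t`). [folklore] -/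
def timeConv (k : ℝ → ℝ) (U : ℝ × ℝ → E) (p : ℝ × ℝ) : E :=
  (k ⋆[ContinuousLinearMap.lsmul ℝ ℝ, volume] fun τ ↦ U (τ, p.2)) p.1

/-- Unfolding `timeConv` as an integral. [folklore] -/
theorem timeConv_eq (k : ℝ → ℝ) (U : ℝ × ℝ → E) (p : ℝ × ℝ) :
    timeConv k U p = ∫ s, k s • U (p.1 - s, p.2) := rfl

omit [NormedSpace ℝ E] in
/-- A slice `s ↦ U (t - s, r)` of a function continuous on the strip `ℝ × V` is continuous when
`r ∈ V`. [folklore] -/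
theorem continuous_slice {U : ℝ × ℝ → E} {V : Set ℝ} (hU : ContinuousOn U (univ ×ˢ V))
    (t : ℝ) {r : ℝ} (hr : r ∈ V) : Continuous fun s : ℝ ↦ U (t - s, r) := by
  have hc : Continuous fun s : ℝ ↦ ((t - s, r) : ℝ × ℝ) := by fun_prop
  exact hU.comp_continuous hc fun s ↦ ⟨mem_univ _, hr⟩

/-- **`L¹–L^∞` bound.** If `‖U (τ, r)‖ ≤ C` for all `τ` then
`‖timeConv k U (t, r)‖ ≤ (∫ ‖k‖) C`. [folklore] -/
theorem norm_timeConv_le {k : ℝ → ℝ} (hk : Integrable k) {U : ℝ × ℝ → E} {p : ℝ × ℝ} {C : ℝ}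
    (hC : ∀ τ, ‖U (τ, p.2)‖ ≤ C) : ‖timeConv k U p‖ ≤ (∫ s, ‖k s‖) * C := by
  rw [timeConv_eq, ← integral_mul_const]
  refine norm_integral_le_of_norm_le (hk.norm.mul_const C) (Eventually.of_forall fun s ↦ ?_)
  rw [norm_smul]
  exact mul_le_mul_of_nonneg_left (hC _) (norm_nonneg _)

/-- The integrand of `timeConv` is integrable when `U` is bounded on the support of `k` along the
slice and continuous on the strip. [folklore] -/
theorem integrable_timeConv_integrand {k : ℝ → ℝ} (hk : Integrable k) {U : ℝ × ℝ → E}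
    {V : Set ℝ} (hU : ContinuousOn U (univ ×ˢ V)) {p : ℝ × ℝ} (hp : p.2 ∈ V) {C : ℝ}
    (hC : ∀ s, k s ≠ 0 → ‖U (p.1 - s, p.2)‖ ≤ C) :
    Integrable fun s ↦ k s • U (p.1 - s, p.2) := by
  refine Integrable.mono' (hk.norm.mul_const C)
    (hk.aestronglyMeasurable.smul (continuous_slice hU p.1 hp).aestronglyMeasurable)
    (Eventually.of_forall fun s ↦ ?_)
  by_cases hs : k s = 0
  · simp [hs]
  · rw [norm_smul]
    exact mul_le_mul_of_nonneg_left (hC s hs) (norm_nonneg _)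

/-- **Differentiation under the integral sign for `timeConv`.** If `U` is continuous on the strip
`ℝ × V` (`V` open) with a continuous Fréchet derivative `U'` there, and near `p₀` both `U` and
`U'` are bounded at the points `(t − s, r)` with `k s ≠ 0`, then `timeConv k U` has Fréchet
derivative `timeConv k U' p₀` at `p₀`. [folklore] -/
theorem hasFDerivAt_timeConv [CompleteSpace E] {k : ℝ → ℝ} (hk : Integrable k) {U : ℝ × ℝ → E}
    {U' : ℝ × ℝ → (ℝ × ℝ →L[ℝ] E)} {V : Set ℝ}
    (hU : ContinuousOn U (univ ×ˢ V)) (hU' : ∀ p ∈ univ ×ˢ V, HasFDerivAt U (U' p) p)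
    (hU'c : ContinuousOn U' (univ ×ˢ V)) {p₀ : ℝ × ℝ} {ε C : ℝ} (hε : 0 < ε)
    (hball : ∀ q : ℝ × ℝ, dist q p₀ < ε → q.2 ∈ V)
    (hbd : ∀ s, k s ≠ 0 → ∀ q : ℝ × ℝ, dist q p₀ < ε →
      ‖U (q.1 - s, q.2)‖ ≤ C ∧ ‖U' (q.1 - s, q.2)‖ ≤ C) :
    HasFDerivAt (timeConv k U) (timeConv k U' p₀) p₀ := by
  have hp₀ : p₀.2 ∈ V := hball p₀ (by simp [hε])
  have key := hasFDerivAt_integral_of_dominated_of_fderiv_le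
    (F := fun (q : ℝ × ℝ) (s : ℝ) ↦ k s • U (q.1 - s, q.2))
    (F' := fun (q : ℝ × ℝ) (s : ℝ) ↦ k s • U' (q.1 - s, q.2))
    (bound := fun s ↦ ‖k s‖ * C) (μ := volume) (x₀ := p₀) (s := ball p₀ ε) (ball_mem_nhds p₀ hε)
    ?_ ?_ ?_ ?_ (hk.norm.mul_const C) ?_
  · exact key
  · filter_upwards [ball_mem_nhds p₀ hε] with q hq
    exact hk.aestronglyMeasurable.smul (continuous_slice hU q.1 (hball q hq)).aestronglyMeasurable
  · exact integrable_timeConv_integrand hk hU hp₀ fun s hs ↦ (hbd s hs p₀ (by simp [hε])).1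
  · exact hk.aestronglyMeasurable.smul (continuous_slice hU'c p₀.1 hp₀).aestronglyMeasurable
  · refine Eventually.of_forall fun s q hq ↦ ?_
    by_cases hs : k s = 0
    · simp [hs]
    · rw [norm_smul]
      exact mul_le_mul_of_nonneg_left (hbd s hs q hq).2 (norm_nonneg _)
  · refine Eventually.of_forall fun s q hq ↦ ?_
    have hq2 : q.2 ∈ V := hball q hq
    have hφ : HasFDerivAt (fun q : ℝ × ℝ ↦ ((q.1 - s, q.2) : ℝ × ℝ))
        ((ContinuousLinearMap.fst ℝ ℝ ℝ).prod (ContinuousLinearMap.snd ℝ ℝ ℝ)) q :=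
      (hasFDerivAt_fst.sub_const s).prodMk hasFDerivAt_snd
    have hcomp := (hU' (q.1 - s, q.2) ⟨mem_univ _, hq2⟩).comp q hφ
    have hL : (U' (q.1 - s, q.2)).comp
        ((ContinuousLinearMap.fst ℝ ℝ ℝ).prod (ContinuousLinearMap.snd ℝ ℝ ℝ)) =
        U' (q.1 - s, q.2) :=
      ContinuousLinearMap.ext fun v ↦ by simp
    rw [hL] at hcomp
    exact hcomp.const_smul (k s)

/-- Coefficients depending only on `r` commute with `timeConv`. [folklore] -/
theorem timeConv_coeff_smul (k : ℝ → ℝ) (c : ℝ → ℝ) (U : ℝ × ℝ → E) (p : ℝ × ℝ) :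
    timeConv k (fun q ↦ c q.2 • U q) p = c p.2 • timeConv k U p := by
  rw [timeConv_eq, timeConv_eq, ← integral_smul]
  congr 1
  funext s
  rw [smul_comm]

/-- Continuous linear maps commute with `timeConv` (integrable integrand). [folklore] -/
theorem timeConv_clm [CompleteSpace E] {F : Type*} [NormedAddCommGroup F] [NormedSpace ℝ F] [CompleteSpace F]
    (L : E →L[ℝ] F) (k : ℝ → ℝ) (U : ℝ × ℝ → E) (p : ℝ × ℝ)
    (hint : Integrable fun s ↦ k s • U (p.1 - s, p.2)) :
    timeConv k (fun q ↦ L (U q)) p = L (timeConv k U p) := by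
  rw [timeConv_eq, timeConv_eq, ← L.integral_comp_comm hint]
  congr 1
  funext s
  rw [L.map_smul]

/-- Evaluation of an operator-valued `timeConv` at a vector. [folklore] -/
theorem timeConv_apply {F : Type*} [NormedAddCommGroup F] [NormedSpace ℝ F]
    (k : ℝ → ℝ) (U : ℝ × ℝ → (F →L[ℝ] E)) (p : ℝ × ℝ) (v : F)
    (hint : Integrable fun s ↦ k s • U (p.1 - s, p.2)) :
    timeConv k U p v = timeConv k (fun q ↦ U q v) p := by
  rw [timeConv_eq, timeConv_eq, ContinuousLinearMap.integral_apply hint]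
  rfl

/-- Additivity of `timeConv` in the function (integrable integrands). [folklore] -/
theorem timeConv_add (k : ℝ → ℝ) (U W : ℝ × ℝ → E) (p : ℝ × ℝ)
    (hU : Integrable fun s ↦ k s • U (p.1 - s, p.2))
    (hW : Integrable fun s ↦ k s • W (p.1 - s, p.2)) :
    timeConv k (fun q ↦ U q + W q) p = timeConv k U p + timeConv k W p := by
  rw [timeConv_eq, timeConv_eq, timeConv_eq, ← integral_add hU hW]
  congr 1
  funext s
  rw [smul_add]

/-- `timeConv k (c • U) = c • timeConv k U` for a constant scalar. [folklore] -/
theorem timeConv_const_smul (k : ℝ → ℝ) (c : ℝ) (U : ℝ × ℝ → E) (p : ℝ × ℝ) :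
    timeConv k (fun q ↦ c • U q) p = c • timeConv k U p :=
  timeConv_coeff_smul k (fun _ ↦ c) U p

/-- `timeConv` of the zero function. [folklore] -/
theorem timeConv_zero_fun (k : ℝ → ℝ) (p : ℝ × ℝ) :
    timeConv k (fun _ ↦ (0 : E)) p = 0 := by
  rw [timeConv_eq]
  simp

/-- `timeConv` only depends on the values of the function on the strip through `p`.
[folklore] -/
theorem timeConv_congr (k : ℝ → ℝ) {U W : ℝ × ℝ → E} {p : ℝ × ℝ}
    (h : ∀ τ, U (τ, p.2) = W (τ, p.2)) : timeConv k U p = timeConv k W p := by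
  simp only [timeConv_eq, h]

/-- **Integration by parts in the time variable.** If `K ∈ C¹` with `K, K'` integrable and
`K → 0`-type decay encoded by integrability, and `V` is bounded on the slice with a bounded
time derivative `Vt` (`HasDerivAt (V(·, r)) (Vt(τ, r)) τ`), then
`timeConv K' V = timeConv K Vt`. [folklore] -/
theorem timeConv_deriv_kernel {K K' : ℝ → ℝ} (hK : Integrable K) (hK' : Integrable K')
    (hKd : ∀ s, HasDerivAt K (K' s) s) (hKb : ∃ B, ∀ s, ‖K s‖ ≤ B)
    {V Vt : ℝ × ℝ → E} {p : ℝ × ℝ} {C : ℝ}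
    (hV : ∀ τ, HasDerivAt (fun τ ↦ V (τ, p.2)) (Vt (τ, p.2)) τ)
    (hVc : Continuous fun τ ↦ Vt (τ, p.2))
    (hVb : ∀ τ, ‖V (τ, p.2)‖ ≤ C) (hVtb : ∀ τ, ‖Vt (τ, p.2)‖ ≤ C) :
    timeConv K' V p = timeConv K Vt p := by
  obtain ⟨B, hB⟩ := hKb
  rw [timeConv_eq, timeConv_eq]
  -- `s ↦ K s • V (t - s, r)` has derivative `K' s • V (t - s) - K s • Vt (t - s)`
  have hVd : ∀ s, HasDerivAt (fun s ↦ V (p.1 - s, p.2)) (-Vt (p.1 - s, p.2)) s := by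
    intro s
    have h1 := hV (p.1 - s)
    have h2 : HasDerivAt (fun s : ℝ ↦ p.1 - s) (-1) s := by
      simpa using (hasDerivAt_id s).const_sub p.1
    have h3 := h1.scomp s h2
    simpa [Function.comp_def] using h3
  have hderiv : ∀ s, HasDerivAt (fun s ↦ K s • V (p.1 - s, p.2))
      (K' s • V (p.1 - s, p.2) - K s • Vt (p.1 - s, p.2)) s := by
    intro s
    have := (hKd s).fun_smul (hVd s)
    refine this.congr_deriv ?_
    rw [smul_neg]
    abel
  have hVcont : Continuous fun s ↦ V (p.1 - s, p.2) :=
    continuous_iff_continuousAt.2 fun s ↦ (hVd s).continuousAt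
  have hVtcont : Continuous fun s ↦ Vt (p.1 - s, p.2) := hVc.comp (by fun_prop)
  have hi1 : Integrable fun s ↦ K' s • V (p.1 - s, p.2) :=
    Integrable.mono' (hK'.norm.mul_const C) (hK'.aestronglyMeasurable.smul hVcont.aestronglyMeasurable)
      (Eventually.of_forall fun s ↦ by
        rw [norm_smul]; exact mul_le_mul_of_nonneg_left (hVb _) (norm_nonneg _))
  have hi2 : Integrable fun s ↦ K s • Vt (p.1 - s, p.2) :=
    Integrable.mono' (hK.norm.mul_const C) (hK.aestronglyMeasurable.smul hVtcont.aestronglyMeasurable)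
      (Eventually.of_forall fun s ↦ by
        rw [norm_smul]; exact mul_le_mul_of_nonneg_left (hVtb _) (norm_nonneg _))
  have hi0 : Integrable fun s ↦ K s • V (p.1 - s, p.2) :=
    Integrable.mono' (hK.norm.mul_const C) (hK.aestronglyMeasurable.smul hVcont.aestronglyMeasurable)
      (Eventually.of_forall fun s ↦ by
        rw [norm_smul]; exact mul_le_mul_of_nonneg_left (hVb _) (norm_nonneg _))
  have h0 := integral_eq_zero_of_hasDerivAt_of_integrable hderiv (hi1.sub hi2) hi0
  rw [integral_sub hi1 hi2, sub_eq_zero] at h0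
  exact h0

/-- **Associativity.** For integrable kernels `a, b` and `V` bounded and continuous on the strip,
`timeConv a (timeConv b V) = timeConv (a ⋆ b) V`. [folklore] -/
theorem timeConv_timeConv [CompleteSpace E] {a b : ℝ → ℝ} (ha : Integrable a) (hb : Integrable b)
    {V : ℝ × ℝ → E} {W : Set ℝ} (hV : ContinuousOn V (univ ×ˢ W)) {p : ℝ × ℝ} (hp : p.2 ∈ W)
    {C : ℝ} (hVb : ∀ τ, ‖V (τ, p.2)‖ ≤ C) :
    timeConv a (timeConv b V) p =
      timeConv (a ⋆[ContinuousLinearMap.mul ℝ ℝ, volume] b) V p := by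
  have hVc : Continuous fun τ ↦ V (τ, p.2) := by
    have := continuous_slice hV 0 hp
    have h2 : (fun τ ↦ V (τ, p.2)) = (fun s ↦ V (0 - s, p.2)) ∘ fun τ ↦ 0 - τ := by
      funext τ; simp
    rw [h2]
    exact this.comp (by fun_prop)
  -- the integrand of the iterated integral and its integrability on `ℝ × ℝ`
  set Φ : ℝ → ℝ → E := fun σ' s ↦ (a s * b (σ' - s)) • V (p.1 - σ', p.2) with hΦ
  have hint : Integrable (Function.uncurry Φ) (volume.prod volume) := by
    have h1 : Integrable (fun q : ℝ × ℝ ↦ a q.2 * b (q.1 - q.2)) (volume.prod volume) :=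
      ha.convolution_integrand (ContinuousLinearMap.mul ℝ ℝ) hb
    have h2 : AEStronglyMeasurable (fun q : ℝ × ℝ ↦ V (p.1 - q.1, p.2)) (volume.prod volume) :=
      (hVc.comp (by fun_prop : Continuous fun q : ℝ × ℝ ↦ p.1 - q.1)).aestronglyMeasurable
    have h3 := h1.smul_bdd C h2 (Eventually.of_forall fun q ↦ hVb _)
    exact h3
  calc timeConv a (timeConv b V) p
      = ∫ s, a s • ∫ σ, b σ • V (p.1 - s - σ, p.2) := by
        rw [timeConv_eq]; rfl
    _ = ∫ s, a s • ∫ σ', b (σ' - s) • V (p.1 - σ', p.2) := by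
        congr 1; funext s; congr 1
        rw [← integral_add_right_eq_self (fun σ' ↦ b (σ' - s) • V (p.1 - σ', p.2)) s]
        congr 1; funext σ
        simp only [add_sub_cancel_right]
        congr 2; ring
    _ = ∫ s, ∫ σ', Φ σ' s := by
        congr 1; funext s
        rw [← integral_smul]
        congr 1; funext σ'
        simp only [hΦ, mul_smul]
    _ = ∫ σ', ∫ s, Φ σ' s := (integral_integral_swap hint).symm
    _ = ∫ σ', (∫ s, a s * b (σ' - s)) • V (p.1 - σ', p.2) := by
        congr 1; funext σ'
        rw [hΦ, integral_smul_const]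
    _ = timeConv (a ⋆[ContinuousLinearMap.mul ℝ ℝ, volume] b) V p := by
        rw [timeConv_eq]; rfl

end EternalPapapetrou.ModeRigidity

end Summit.FinalStateConjecture.FinalStateConjecture.Theorems
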